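import Summits.QuantumFields.YangMills.Theorems.FlatTubeReductionAmplitudeBootstrap
import HarnessLib

/-!
# The `u`-core lies inside the `1`-core: `kinDefect(oT u v, oT u v′, g) ≤ D` with colour pinning ⇒ `kinDefect(oT 1 v, oT 1 v′, g) ≤ 2D + 8|E|τ_u²·amp₃²`,
# `amp₃ = (9L(√D + √2(‖v̂‖+‖v̂′‖)) + ε)(1 + θ + θ²) + θ²·36L·a`, `a = √2‖v̂‖ + τ_u`, `θ = 18La`
# (the set inclusion behind the tails AT `u` of the log-free moment machine; route `FlatTubeReduction`, crux K1 `NearFlatRatioLaw` stmt-QuantumFields-24720; seat `ym-line-ftr-p1` g12;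
# rate twin «ratepack-v3 / frozen fibres»; R2b1 RECORD rung — no summit statement is proved here)

WHY (memo `Cruxes/NearFlatRatioLaw/Lines/ratepack-v3-frozen-g12.md` §5.8).  Composition of `…AmplitudeBootstrap.amp_bootstrap_three` (amplitude of the pinned gauge field on the
`u`-level set) with `…KineticDefectSlowShift.kinDefect_orthoTube_slow_ge` (the defect at `1` is at most twice the defect at `u` plus `8|E|τ_u²amp²`), the link amplitudes of the tube
pair being `a = √2‖v̂‖ + τ_u` and `b = √2(‖v̂‖ + ‖v̂′‖)` (lane A's `norm_su2Quat_orthoTube_sub_one_le`, `norm_su2Quat_orthoTube_sub_orthoTube_le`):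
  ★★ `kinDefect_one_le_of_kinDefect_slow_le`.
With `D = T/(2β)`, `T = β^{1/6}`, `τ_u ≍ δ₁ = β^{-1/6}`, `‖v̂‖ ≲ β^{-5/12}`: `8|E|βτ_u²amp₃² ≲ β·β^{-1/3}·L²(T/β + L⁶β^{-1}) → O(L⁸β^{-1/3})·… ≪ T`, so `{N_u ≤ T/2} ∩ {pinned} ∩ {v-core} ⊆ {N ≤ T}`
eventually (numerology left to the assembly).
HONEST FRAMING: quaternion bookkeeping; femto rung R2b1 (RECORD label); not infinite volume, not a gap, not Clay.  No defs, no named facts, no `sorry`.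
-/

set_option autoImplicit false

noncomputable section

open MeasureTheory Filter Topology Real Set
open scoped BigOperators Quaternion
open Literature.MathematicalPhysics.QuantumFieldTheory
open Literature.MathematicalPhysics.QuantumLattice

namespace Summit.QuantumFields.YangMills.Theorems.FemtoTransferGap.RateTube

open Summit.QuantumFields.YangMills.Theorems.FemtoTransferGap
open Summit.QuantumFields.YangMills.Theorems.FemtoTransferGap.TwoLattice
open Summit.QuantumFields.YangMills.Theorems.FemtoTransferGap.TwoLattice.ConstTube
open Summit.QuantumFields.YangMills.Theorems.FemtoTransferGap.TwoLattice.Avg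

variable {L : ℕ} [NeZero L]

/-- ★★ **The `u`-level set lies in the `1`-level set (pinned gauge fields).**  Capped fibres `v, v′`, a slow datum `u` with `‖q(u_k) − 1‖ ≤ τ_u`, a colour-pinned gauge field
(`colourMean g ∈ fpBall ε`) with `kinDefect (oT u v) (oT u v′) g ≤ D`, and the first-pass smallness of the bootstrap for `a = √2‖v̂‖ + τ_u`, `b = √2(‖v̂‖ + ‖v̂′‖)`.  Then
`kinDefect (oT 1 v) (oT 1 v′) g ≤ 2D + 8|E|·τ_u²·amp₃²`, `amp₃ = (9L(√D + b) + ε)(1 + θ + θ²) + θ²·36La`, `θ = 18La`. [folklore] -/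
theorem kinDefect_one_le_of_kinDefect_slow_le (u : GaugeConfig 3 1 SU2) {v v' : Edge 3 L → Fin 3 → ℝ} (hv1 : ∀ e, ∑ a, v e a ^ 2 ≤ 1) (hv'1 : ∀ e, ∑ a, v' e a ^ 2 ≤ 1)
    {τu : ℝ} (hu : ∀ k : Fin 3, ‖su2Quat (u (0, k)) - 1‖ ≤ τu) {g : Site 3 L → SU2} {ε D : ℝ} (hW : colourMean L g ∈ fpBall ε)
    (hD : kinDefect L (orthoTube L u v) (orthoTube L u v') g ≤ D)
    (hsmall : 3 * L * (Real.sqrt D + 4 * (Real.sqrt 2 * ‖linkEmbed L v‖ + τu) + Real.sqrt 2 * (‖linkEmbed L v‖ + ‖linkEmbed L v'‖)) < 1)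
    (htwo : 9 * L * (Real.sqrt D + 4 * (Real.sqrt 2 * ‖linkEmbed L v‖ + τu) + Real.sqrt 2 * (‖linkEmbed L v‖ + ‖linkEmbed L v'‖)) + ε ≤ 2) :
    kinDefect L (orthoTube L 1 v) (orthoTube L 1 v') g ≤ 2 * D + 8 * (Fintype.card (Edge 3 L) : ℝ) * τu ^ 2 *
      ((9 * L * (Real.sqrt D + Real.sqrt 2 * (‖linkEmbed L v‖ + ‖linkEmbed L v'‖)) + ε) *
          (1 + 18 * L * (Real.sqrt 2 * ‖linkEmbed L v‖ + τu) + (18 * L * (Real.sqrt 2 * ‖linkEmbed L v‖ + τu)) ^ 2) +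
        (18 * L * (Real.sqrt 2 * ‖linkEmbed L v‖ + τu)) ^ 2 * (36 * L * (Real.sqrt 2 * ‖linkEmbed L v‖ + τu))) ^ 2 := by
  -- link amplitudes of the tube pair
  have ha : ∀ e, ‖su2Quat (orthoTube L u v e) - 1‖ ≤ Real.sqrt 2 * ‖linkEmbed L v‖ + τu := fun e =>
    (norm_su2Quat_orthoTube_sub_one_le u hv1 e).trans (add_le_add le_rfl (hu e.2))
  have hb : ∀ e, ‖su2Quat (orthoTube L u v e) - su2Quat (orthoTube L u v' e)‖ ≤ Real.sqrt 2 * (‖linkEmbed L v‖ + ‖linkEmbed L v'‖) := fun e => by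
    have h := norm_su2Quat_orthoTube_sub_orthoTube_le u u hv1 hv'1 e
    rw [sub_self, norm_zero, add_zero] at h
    linarith
  -- the bootstrap amplitude
  have hamp := amp_bootstrap_three (orthoTube L u v) (orthoTube L u v') ha hb hD hW hsmall htwo
  -- the slow shift
  have h := kinDefect_orthoTube_slow_ge (L := L) u v v' g hu hamp
  linarith

end Summit.QuantumFields.YangMills.Theorems.FemtoTransferGap.RateTube

end
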